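import Literature.NumberTheory.Automorphic.ArchRankOneCasimirJetsCayley            -- ★ FILE 4b (this seat, p850929): the all-orders elliptic heads on `U(J)`, Cayley frame, cones of `(1+Ω_J)ᵏ f`; brings ★ FILE 3 (split ladder)
import Literature.NumberTheory.Automorphic.ArchRankOneSplitOrbitEven               -- ★ FILE 4a (this seat, p850908): evenness, odd `x`-jets vanish
import Literature.NumberTheory.Automorphic.ArchRankOneSplitConeMatching            -- ★ (A0-c) p850345 (F0P3a-p05): `exists_tendsto_abs_sub_smul_integral_descConj_hypBlockGL_cone`; brings ★ (IWA) `rotLift` kit, ★ (A0)∕(A0-b) p850189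
import HarnessLib

/-!
# (A0-CASIMIR-∞) FILE 4c — THE JUNCTION: the ALL-ORDERS RANK-ONE JUMP RELATION on `U(J) = U(1,1)` with the ORDER-0 constants
# `∂_ψⁿ F_f(0⁺) − ∂_ψⁿ F_f(0⁻) = (C₁∕C₂) · iⁿ · ∂_xⁿ G_f(0)` (Harish-Chandra; Shelstad 1979 Prop. 4.5; Varadarajan 1989 §6.4 Thm 24; Bouaziz 1994 (I₃))

Topic `NumberTheory/Automorphic`; namespace `Literature.NumberTheory.Automorphic.UnitaryGroup`.  THEOREMS ONLY (no `def`, no instance, no notation, no axiom, no named fact, no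
`sorry`).  Cell `pub/hodgecm-mathlib`, crux H413 (`stmt-HodgeConjecture-24833`), line LH3 (closer stub `stub_N9`, direct road), letter L1∕L3′ pay-down brick **(A0-CASIMIR-∞)
FILE 4c = item (iii) of LH3-plan (g3) 2026-09-02T08:51:42Z «=»: «the JUNCTION = the all-orders rank-one jump relation with the SAME constant as order 0»** (F0P3a-p09 (g6)).
Everything elliptic is ★ (ELL-∞) (LH3-p04 (g4)) through ★ FILE 4b; everything split is ★ FILE 2∕3∕4a over ★ (A0)∕(A0-b)∕(A0-c)∕(A0-smooth) (F0P3a-p05 lineage); CONSUMED BY NAME.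

THE MATHEMATICS.  `G = U(J)`, `hJ`, `ν` a Haar measure on `G` (two-sided), `μ ≠ 0` an invariant Radon measure on `G ⧸ T` (`T` the split torus), `θ ∈ ℝ`, `z = e^{iθ}`, `f ∈ C_c^∞(M₂(ℂ), E)`,
`Ω_J` the split-frame Casimir (★ FILE 1, hypothesis `hΩJ`).  ELLIPTIC family `F_f(ψ) = 2 sin ψ • ∫_G f(↑↑(h · P t_z(ψ) P⁻¹ · h⁻¹)) dν` (the Cayley compact torus through `z·1`);
SPLIT functional `G_f(x) = |eˣ − e⁻ˣ| • ∫_{G⧸T} f(↑↑(y t_{x,θ} y⁻¹)) dμ` for `x ≠ 0`, extended continuously (★ p850603: a `C^∞` extension exists).  Then with the ORDER-0 constants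
`C₁ > 0` (the (K0±) jump constant of `ν`: `F_g(0^±) = ±C₁·cone^±_P(g)`) and `C₂ > 0` (the (A0-c) constant of `μ`: `G_g(0) = C₂·(cone⁺_P + cone⁻_P)(g)`), for EVERY `n`:
  **`∂_ψⁿ F_f` has one-sided limits at `ψ = 0` and `∂_ψⁿF_f(0⁺) − ∂_ψⁿF_f(0⁻) = (C₁∕C₂) · Re(iⁿ)-free form: `= (C₁∕C₂)(−1)ᵏ ∂_x^{2k}G_f(0)` (`n = 2k`), `= 0 = ∂_x^{2k+1}G_f(0)` (`n` odd)**,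
i.e. for `E = ℂ`: `HasOneSidedJump (∂_ψⁿ F_f) ((C₁∕C₂) · iⁿ · ∂_xⁿ G_f(0))` — Bouaziz's (I₃) with `d = 1` and the Cayley scalar `i^{#normal derivatives}`, one constant for all orders.
PROOF.  Even `n = 2k`: ★ FILE 4b gives `∂^{2k}F_f(0^±) = ±(−1)ᵏ C₁ cone^±_P((1+Ω_J)ᵏ f)`; §1 pins the split side: `G_f = C • Λ_f` (★ (A0-b), `Λ_f` the `K₁ × N` half-chart integral of
★ p850603, `C^∞` by ★ FILE 3), `Λ_f⁽²ᵏ⁾(0) = Λ_{(1+Ω_J)ᵏ f}(0)` (★ FILE 3 ladder) and `C • Λ_g(0) = C₂ • cone_P(g)` for every `g ∈ C_c` (★ (A0) vs ★ (A0-c): two limits of the same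
function along `𝓝[≠] 0`), so `∂_x^{2k} G_f(0) = C₂ · (cone⁺_P + cone⁻_P)((1+Ω_J)ᵏ f)`.  Odd `n`: ★ FILE 4b (two-sided limit) and ★ FILE 4a (`∂_x^{odd} G_f(0) = 0`, evenness).

WHAT IS PROVED.
* §1 **`exists_iteratedDeriv_eq_cone_of_eqOn_abs_sub_smul_integral_descConj`** — THE SPLIT SIDE PINNED: `∃ C₂ > 0` with the ★ (A0-c) property VERBATIM (so ★ `eq_of_tendsto_cone`
  identifies it) AND, for every `f ∈ C_c^∞`, `θ`, every `G` continuous at `0` agreeing with `G_f` off `0`, every `k`: `G⁽²ᵏ⁾(0) = C₂ • cone_P^{full}((1+Ω_J)ᵏ f, e^{iθ})`,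
  `G⁽²ᵏ⁺¹⁾(0) = 0`.
* §2 **`exists_rankOne_jump_allOrders_of_eq_over`** (Banach `E`: even∕odd clauses with explicit one-sided limits) and **`exists_hasOneSidedJump_iteratedDeriv_allOrders_of_eq_over`**
  (`E = ℂ`: `HasOneSidedJump (ψ ↦ ∂ⁿF_f ψ) ((C₁∕C₂ : ℂ) * I ^ n * ∂ⁿ G 0)`), both carrying the order-0 pins of `C₁` (for `f ∈ C_c^∞`, `k = 0` of ★ FILE 4b) and `C₂` (★ (A0-c)).
NOTE on «the same constant»: `C₂` IS the ★ (A0-c) constant (stated with its defining property for ALL `f ∈ C_c`, unique by ★ `eq_of_tendsto_cone`); `C₁` is stated with the (K0±)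
property for `f ∈ C_c^∞` (all that ★ (ELL-∞) is typed for); it coincides with ★ p850353's by one smooth test function with non-zero cone (not needed by letter L1, whose
`jc′` is existential, nor by organ J, which is ★ kernel-closed with its own order-0 witnesses).
HONEST LABEL: HC_CM is proved only modulo the 7 printed citations (2 remaining: hLiu418 = `stmt-HodgeConjecture-24832`, h413 = `stmt-HodgeConjecture-24833`) until rung 0 closes;
count-neutral rank-one kernel of letter L1's clause (I₃); the multi-place dress ((α3)∕(α4), LH3-p01 (g4)) is not here.

## References
* [Shelstad1979] D. Shelstad, *Characters and inner forms of a quasi-split group over ℝ*, Compositio Math. 39 (1979), Lemma 4.3 p. 25, Prop. 4.5 p. 26 (the jump `i·d(α)·`Cayley reading).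
* [Varadarajan1989] V. S. Varadarajan, *An Introduction to Harmonic Analysis on Semisimple Lie Groups*, Cambridge Stud. Adv. Math. 16 (1989), §6.4 Lemma 21 (c), Thms 23–24.
* [Bouaziz1994IntegralesOrbitales] A. Bouaziz, *Intégrales orbitales sur les groupes de Lie réductifs*, Ann. Sci. ÉNS 27 (1994), §3.2 (I₃) p. 580.
* [Rogawski1990] J. D. Rogawski, *Automorphic Representations of Unitary Groups in Three Variables*, Ann. of Math. Stud. 123 (1990), §8.2 pp. 119–123, Prop. 8.2.1.
* [GetzHahn2024] J. R. Getz, H. Hahn, *An Introduction to Automorphic Representations*, GTM 300 (2024), Thm. 3.2.2.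
-/

set_option autoImplicit false

noncomputable section

open MeasureTheory Measure Set Filter Topology Complex NumberField NumberField.InfinitePlace
open scoped ENNReal NNReal ComplexConjugate ContDiff Matrix.Norms.Operator MatrixGroups Real

namespace Literature.NumberTheory.Automorphic

open Literature.MeasureTheory.Group Literature.NumberTheory.Automorphic.Shelstad1979.StableOrbitalIntegrals

namespace UnitaryGroup

open Literature.NumberTheory.Rogawski1990
open Literature.NumberTheory.Automorphic.UnitaryGroup.HeisRing Literature.NumberTheory.Automorphic.UnitaryGroup.LineRing

/-! ## §1 The split side pinned: `∂_x^{2k} G_f(0) = C₂ · cone_P((1+Ω_J)ᵏ f)`, `∂_x^{2k+1} G_f(0) = 0` -/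

section Split

variable {J : Matrix (Fin 2) (Fin 2) ℂ} (hJ : J = (StdForm.antidiagonal 2).over ℂ) [Fact (0 < 2 * π)]
  [MeasurableSpace ↥(unitaryGroupOfForm (starRingEnd ℂ) J)] [BorelSpace ↥(unitaryGroupOfForm (starRingEnd ℂ) J)]
  [MeasurableSpace (↥(unitaryGroupOfForm (starRingEnd ℂ) J) ⧸ torusU (starRingEnd ℂ) J)] [BorelSpace (↥(unitaryGroupOfForm (starRingEnd ℂ) J) ⧸ torusU (starRingEnd ℂ) J)]
  (μ : Measure (↥(unitaryGroupOfForm (starRingEnd ℂ) J) ⧸ torusU (starRingEnd ℂ) J))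
  [SMulInvariantMeasure ↥(unitaryGroupOfForm (starRingEnd ℂ) J) (↥(unitaryGroupOfForm (starRingEnd ℂ) J) ⧸ torusU (starRingEnd ℂ) J) μ] [IsFiniteMeasureOnCompacts μ]
  {E : Type*} [NormedAddCommGroup E] [NormedSpace ℝ E] [CompleteSpace E]

omit [CompleteSpace E] in
include hJ in
/-- **THE SPLIT SIDE OF THE ALL-ORDERS JUMP RELATION, PINNED TO THE ORDER-0 CONSTANT `C₂`.**  For every non-zero invariant Radon `μ` on `U(J) ⧸ T` there is `C₂ > 0` with
(a) the ★ (A0-c) property VERBATIM — for every `f ∈ C_c(M₂(ℂ), E)` and `θ`, `|eˣ − e⁻ˣ| • ∫_{U(J)⧸T} f(↑↑(y t_{x,θ} y⁻¹)) dμ → C₂ • (cone⁺_P + cone⁻_P)(f, e^{iθ})` as `x → 0`, `x ≠ 0` — and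
(b) for every `f ∈ C_c^∞(M₂(ℂ), E)`, `θ`, every `G : ℝ → E` continuous at `0` that agrees with this functional off `0`, and every `k`:
**`G⁽²ᵏ⁾(0) = C₂ • (cone⁺_P + cone⁻_P)((1+Ω_J)ᵏ f, e^{iθ})`** and **`G⁽²ᵏ⁺¹⁾(0) = 0`**.  (`G = C • Λ_f` with ★ (A0-b)'s `K₁ × N` chart integral, ★ FILE 3's ladder
`Λ_f⁽²ᵏ⁾(0) = Λ_{(1+Ω_J)ᵏf}(0)`, the identification `C • Λ_g(0) = C₂ • cone_P(g)` by uniqueness of the limit along `𝓝[≠] 0` of ★ (A0) and ★ (A0-c), and ★ FILE 4a at odd orders.)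
[cite: Varadarajan1989, §6.4 Thms 23–24] [cite: Shelstad1979, Lemma 4.3 p. 25] [cite: Rogawski1990, §8.2 pp. 119–122] -/
theorem exists_iteratedDeriv_eq_cone_of_eqOn_abs_sub_smul_integral_descConj (hμ : μ ≠ 0) (ΩJ : (Matrix (Fin 2) (Fin 2) ℂ → E) → Matrix (Fin 2) (Fin 2) ℂ → E)
    (hΩJ : ∀ (g : Matrix (Fin 2) (Fin 2) ℂ → E) (Y : Matrix (Fin 2) (Fin 2) ℂ), ΩJ g Y =
      -(fderiv ℝ (fderiv ℝ g) Y (Y * !![0, I; I, 0]) (Y * !![0, I; I, 0]) + fderiv ℝ g Y (Y * !![0, I; I, 0] * !![0, I; I, 0])) +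
        (fderiv ℝ (fderiv ℝ g) Y (Y * !![1, 0; 0, -1]) (Y * !![1, 0; 0, -1]) + fderiv ℝ g Y (Y * !![1, 0; 0, -1] * !![1, 0; 0, -1])) +
        (fderiv ℝ (fderiv ℝ g) Y (Y * !![0, I; -I, 0]) (Y * !![0, I; -I, 0]) + fderiv ℝ g Y (Y * !![0, I; -I, 0] * !![0, I; -I, 0]))) :
    ∃ C₂ : ℝ, 0 < C₂ ∧
      (∀ (f : Matrix (Fin 2) (Fin 2) ℂ → E), Continuous f → HasCompactSupport f → ∀ θ : ℝ,
        Tendsto (fun x : ℝ => |Real.exp x - Real.exp (-x)| •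
          ∫ y, descConj (⟨hypBlockGL x θ, hypBlockGL_mem_of_eq_over hJ x θ⟩ : ↥(unitaryGroupOfForm (starRingEnd ℂ) J)) (torusU (starRingEnd ℂ) J) (LineRing.forall_mem_torusU_comm (starRingEnd ℂ) J (hypBlockGL_mem_torusU hJ x θ)) (fun g : ↥(unitaryGroupOfForm (starRingEnd ℂ) J) => f ((g : GL (Fin 2) ℂ) : Matrix (Fin 2) (Fin 2) ℂ)) y ∂μ)
          (𝓝[≠] 0) (𝓝 (C₂ • ((∫ p in Ioi (0 : ℝ) ×ˢ Ioc (0 : ℝ) (2 * π),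
            f ((!![(1 : ℂ), 1; 1, -1] : Matrix (Fin 2) (Fin 2) ℂ) *
              (Complex.exp ((θ : ℂ) * Complex.I) • (1 : Matrix (Fin 2) (Fin 2) ℂ) +
                p.1 • Matrix.diagonal ![Complex.exp ((θ : ℂ) * Complex.I) * Complex.I, -(Complex.exp ((θ : ℂ) * Complex.I) * Complex.I)] +
                p.1 • !![(0 : ℂ), -(Complex.exp ((θ : ℂ) * Complex.I) * Complex.I) * Complex.exp (-((p.2 : ℂ) * Complex.I));
                  (Complex.exp ((θ : ℂ) * Complex.I) * Complex.I) * Complex.exp ((p.2 : ℂ) * Complex.I), 0]) *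
              !![(1 / 2 : ℂ), 1 / 2; 1 / 2, -(1 / 2)])) +
          ∫ p in Ioi (0 : ℝ) ×ˢ Ioc (0 : ℝ) (2 * π),
            f ((!![(1 : ℂ), 1; 1, -1] : Matrix (Fin 2) (Fin 2) ℂ) *
              (Complex.exp ((θ : ℂ) * Complex.I) • (1 : Matrix (Fin 2) (Fin 2) ℂ) +
                p.1 • Matrix.diagonal ![-(Complex.exp ((θ : ℂ) * Complex.I) * Complex.I), Complex.exp ((θ : ℂ) * Complex.I) * Complex.I] +
                p.1 • !![(0 : ℂ), (Complex.exp ((θ : ℂ) * Complex.I) * Complex.I) * Complex.exp (-((p.2 : ℂ) * Complex.I));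
                  -(Complex.exp ((θ : ℂ) * Complex.I) * Complex.I) * Complex.exp ((p.2 : ℂ) * Complex.I), 0]) *
              !![(1 / 2 : ℂ), 1 / 2; 1 / 2, -(1 / 2)]))))) ∧
      ∀ (f : Matrix (Fin 2) (Fin 2) ℂ → E), ContDiff ℝ ∞ f → HasCompactSupport f → ∀ (θ : ℝ) (G : ℝ → E), ContinuousAt G 0 →
        (∀ x : ℝ, x ≠ 0 → G x = |Real.exp x - Real.exp (-x)| •
          ∫ y, descConj (⟨hypBlockGL x θ, hypBlockGL_mem_of_eq_over hJ x θ⟩ : ↥(unitaryGroupOfForm (starRingEnd ℂ) J)) (torusU (starRingEnd ℂ) J) (LineRing.forall_mem_torusU_comm (starRingEnd ℂ) J (hypBlockGL_mem_torusU hJ x θ)) (fun g : ↥(unitaryGroupOfForm (starRingEnd ℂ) J) => f ((g : GL (Fin 2) ℂ) : Matrix (Fin 2) (Fin 2) ℂ)) y ∂μ) →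
        ∀ k : ℕ, iteratedDeriv (2 * k) G 0 = C₂ • ((∫ p in Ioi (0 : ℝ) ×ˢ Ioc (0 : ℝ) (2 * π),
            ((fun g => g + ΩJ g)^[k] f) ((!![(1 : ℂ), 1; 1, -1] : Matrix (Fin 2) (Fin 2) ℂ) *
              (Complex.exp ((θ : ℂ) * Complex.I) • (1 : Matrix (Fin 2) (Fin 2) ℂ) +
                p.1 • Matrix.diagonal ![Complex.exp ((θ : ℂ) * Complex.I) * Complex.I, -(Complex.exp ((θ : ℂ) * Complex.I) * Complex.I)] +
                p.1 • !![(0 : ℂ), -(Complex.exp ((θ : ℂ) * Complex.I) * Complex.I) * Complex.exp (-((p.2 : ℂ) * Complex.I));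
                  (Complex.exp ((θ : ℂ) * Complex.I) * Complex.I) * Complex.exp ((p.2 : ℂ) * Complex.I), 0]) *
              !![(1 / 2 : ℂ), 1 / 2; 1 / 2, -(1 / 2)])) +
          ∫ p in Ioi (0 : ℝ) ×ˢ Ioc (0 : ℝ) (2 * π),
            ((fun g => g + ΩJ g)^[k] f) ((!![(1 : ℂ), 1; 1, -1] : Matrix (Fin 2) (Fin 2) ℂ) *
              (Complex.exp ((θ : ℂ) * Complex.I) • (1 : Matrix (Fin 2) (Fin 2) ℂ) +
                p.1 • Matrix.diagonal ![-(Complex.exp ((θ : ℂ) * Complex.I) * Complex.I), Complex.exp ((θ : ℂ) * Complex.I) * Complex.I] +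
                p.1 • !![(0 : ℂ), (Complex.exp ((θ : ℂ) * Complex.I) * Complex.I) * Complex.exp (-((p.2 : ℂ) * Complex.I));
                  -(Complex.exp ((θ : ℂ) * Complex.I) * Complex.I) * Complex.exp ((p.2 : ℂ) * Complex.I), 0]) *
              !![(1 / 2 : ℂ), 1 / 2; 1 / 2, -(1 / 2)])) ∧
          iteratedDeriv (2 * k + 1) G 0 = 0 := by
  obtain ⟨C₂, hC₂, hA0c⟩ := exists_tendsto_abs_sub_smul_integral_descConj_hypBlockGL_cone hJ μ hμ (E := E)
  refine ⟨C₂, hC₂, hA0c, fun f hf hfc θ G hG0 hG k => ⟨?_, (iteratedDeriv_odd_eq_zero_of_eqOn_abs_sub_smul_integral_descConj hJ μ _ θ hG k).2⟩⟩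
  haveI : LocallyCompactSpace ↥(unitaryGroupOfForm (starRingEnd ℂ) J) := locallyCompactSpace_unitaryGroupOfForm_complex J
  haveI : SecondCountableTopology ↥(unitaryGroupOfForm (starRingEnd ℂ) J) := secondCountableTopology_unitaryGroupOfForm_complex J
  have hT : IsClosed (torusU (starRingEnd ℂ) J : Set ↥(unitaryGroupOfForm (starRingEnd ℂ) J)) := isClosed_torusU_two _ _
  have hN : IsClosed (unipotentU (starRingEnd ℂ) J : Set ↥(unitaryGroupOfForm (starRingEnd ℂ) J)) := isClosed_unipotentU _ _
  haveI : LocallyCompactSpace ↥(torusU (starRingEnd ℂ) J) := hT.isClosedEmbedding_subtypeVal.locallyCompactSpace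
  haveI : LocallyCompactSpace ↥(unipotentU (starRingEnd ℂ) J) := hN.isClosedEmbedding_subtypeVal.locallyCompactSpace
  haveI : SecondCountableTopology ↥(unipotentU (starRingEnd ℂ) J) := TopologicalSpace.Subtype.secondCountableTopology _
  haveI : BorelSpace ↥(torusU (starRingEnd ℂ) J) := Subtype.borelSpace _
  haveI : BorelSpace ↥(unipotentU (starRingEnd ℂ) J) := Subtype.borelSpace _
  -- the circle `K₁` (★ (IWA)): compact, `G = K₁ · B`
  set ι : AddCircle (2 * π) → ↥(unitaryGroupOfForm (starRingEnd ℂ) J) :=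
    fun s => ⟨archPlaneLiftGL 1 (rotMat s) (det_rotMat s), archPlaneLiftGL_rotMat_mem hJ s⟩ with hι
  have hιadd : ∀ s t, ι (s + t) = ι s * ι t := fun s t => Subtype.ext (archPlaneLiftGL_rotMat_add s t)
  have hι0 : ι 0 = 1 := Subtype.ext archPlaneLiftGL_rotMat_zero
  have hιneg : ∀ s, ι (-s) = (ι s)⁻¹ := fun s => Subtype.ext (by
    rw [Subgroup.coe_inv]; exact archPlaneLiftGL_rotMat_neg s)
  let K : Subgroup ↥(unitaryGroupOfForm (starRingEnd ℂ) J) :=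
    { carrier := Set.range ι
      one_mem' := ⟨0, hι0⟩
      mul_mem' := by
        rintro _ _ ⟨s, rfl⟩ ⟨t, rfl⟩
        exact ⟨s + t, hιadd s t⟩
      inv_mem' := by
        rintro _ ⟨s, rfl⟩
        exact ⟨-s, hιneg s⟩ }
  have hK : IsCompact (K : Set ↥(unitaryGroupOfForm (starRingEnd ℂ) J)) := isCompact_range_rotLift hJ
  have hKB : ∀ g : ↥(unitaryGroupOfForm (starRingEnd ℂ) J), ∃ k ∈ K, ∃ b ∈ borelU (starRingEnd ℂ) J, g = k * b := by
    intro g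
    obtain ⟨s, b, hb, hg⟩ := exists_rotLift_mul_mem_borelU hJ g
    exact ⟨ι s, ⟨s, rfl⟩, b, hb, hg⟩
  haveI : CompactSpace ↥K := isCompact_iff_compactSpace.1 hK
  haveI : LocallyCompactSpace ↥K := hK.isClosed.isClosedEmbedding_subtypeVal.locallyCompactSpace
  haveI : BorelSpace ↥K := Subtype.borelSpace _
  set κ : Measure ↥K := Measure.haar with hκ
  set μN : Measure ↥(unipotentU (starRingEnd ℂ) J) := Measure.haar with hμN
  set α : Measure ↥(torusU (starRingEnd ℂ) J) := Measure.haar with hα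
  obtain ⟨C, hC0, hμC⟩ := exists_measure_quotient_torusU_complex_two_eq_smul_map hJ hK hKB κ α μN μ hμ
  -- the half-chart family on `K₁ × N` and ★ FILE 3's ladder
  obtain ⟨Λ, hΛ⟩ : ∃ Λ : (Matrix (Fin 2) (Fin 2) ℂ → E) → ℝ → E, ∀ (g : Matrix (Fin 2) (Fin 2) ℂ → E) (x : ℝ), Λ g x =
      ∫ p : ↥K × ↥(unipotentU (starRingEnd ℂ) J), g ((((((p.1 : ↥K) : ↥(unitaryGroupOfForm (starRingEnd ℂ) J)) * (((⟨hypBlockGL 0 θ, hypBlockGL_mem_of_eq_over hJ 0 θ⟩ : ↥(unitaryGroupOfForm (starRingEnd ℂ) J))) * ((⟨hypBlockGL (x / 2) 0, hypBlockGL_mem_of_eq_over hJ (x / 2) 0⟩ : ↥(unitaryGroupOfForm (starRingEnd ℂ) J))) * ((p.2 : ↥(unipotentU (starRingEnd ℂ) J)) : ↥(unitaryGroupOfForm (starRingEnd ℂ) J)) * ((⟨hypBlockGL (x / 2) 0, hypBlockGL_mem_of_eq_over hJ (x / 2) 0⟩ : ↥(unitaryGroupOfForm (starRingEnd ℂ)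 J)))) * ((p.1 : ↥K) : ↥(unitaryGroupOfForm (starRingEnd ℂ) J))⁻¹ : ↥(unitaryGroupOfForm (starRingEnd ℂ) J))) : GL (Fin 2) ℂ) : Matrix (Fin 2) (Fin 2) ℂ) ∂(κ.prod μN) := ⟨fun g x => _, fun _ _ => rfl⟩
  obtain ⟨hΛs, -, -⟩ := iteratedDeriv_integral_prod_conj_hypBlockGL_half hJ κ μN hK ΩJ hΩJ θ Λ hΛ hf hfc k
  obtain ⟨hz, -⟩ := iteratedDeriv_integral_prod_conj_hypBlockGL_half_zero hJ κ μN hK ΩJ hΩJ θ Λ hΛ hf hfc k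
  -- `G = C • Λ f`: off `0` by ★ (A0-b), at `0` by continuity
  have hF : Continuous fun g : ↥(unitaryGroupOfForm (starRingEnd ℂ) J) => f ((g : GL (Fin 2) ℂ) : Matrix (Fin 2) (Fin 2) ℂ) := hf.continuous.comp (Units.continuous_val.comp continuous_subtype_val)
  have hoff : ∀ x : ℝ, x ≠ 0 → G x = (C : ℝ) • Λ f x := fun x hx => by
    rw [hG x hx, hΛ]
    exact abs_sub_smul_integral_descConj_hypBlockGL_eq_smul_integral_prod hJ κ μN μ hμC (fun g : ↥(unitaryGroupOfForm (starRingEnd ℂ) J) => f ((g : GL (Fin 2) ℂ) : Matrix (Fin 2) (Fin 2) ℂ)) hF θ hx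
  have h0 : G 0 = (C : ℝ) • Λ f 0 := by
    have h1 : Tendsto G (𝓝[≠] 0) (𝓝 (G 0)) := hG0.tendsto.mono_left nhdsWithin_le_nhds
    have h2 : Tendsto (fun x => (C : ℝ) • Λ f x) (𝓝[≠] 0) (𝓝 ((C : ℝ) • Λ f 0)) :=
      ((hΛs.continuous.tendsto 0).const_smul (C : ℝ)).mono_left nhdsWithin_le_nhds
    have h1' : Tendsto (fun x => (C : ℝ) • Λ f x) (𝓝[≠] 0) (𝓝 (G 0)) :=
      h1.congr' (eventually_nhdsWithin_of_forall fun x hx => hoff x hx)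
    exact tendsto_nhds_unique h1' h2
  have hGe : G = fun x => (C : ℝ) • Λ f x := funext fun x => by
    by_cases hx : x = 0
    · rw [hx]; exact h0
    · exact hoff x hx
  -- the value `C • Λ_g(0) = C₂ • cone_P(g)` for `g = (1+Ω_J)ᵏ f` (two limits of one function along `𝓝[≠] 0`)
  obtain ⟨hTs, hTc⟩ := iterate_casimirJ_mem ΩJ hΩJ hf hfc k
  have hFk : Continuous fun g : ↥(unitaryGroupOfForm (starRingEnd ℂ) J) => ((fun g => g + ΩJ g)^[k] f) ((g : GL (Fin 2) ℂ) : Matrix (Fin 2) (Fin 2) ℂ) := hTs.continuous.comp (Units.continuous_val.comp continuous_subtype_val)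
  have hFkc : HasCompactSupport fun g : ↥(unitaryGroupOfForm (starRingEnd ℂ) J) => ((fun g => g + ΩJ g)^[k] f) ((g : GL (Fin 2) ℂ) : Matrix (Fin 2) (Fin 2) ℂ) := hasCompactSupport_comp_coe hJ _ hTc
  have hlimA0 := tendsto_abs_sub_smul_integral_descConj_hypBlockGL hJ κ μN μ hK hμC (fun g : ↥(unitaryGroupOfForm (starRingEnd ℂ) J) => ((fun g => g + ΩJ g)^[k] f) ((g : GL (Fin 2) ℂ) : Matrix (Fin 2) (Fin 2) ℂ)) hFk hFkc θ
  have hlimA0c := hA0c ((fun g => g + ΩJ g)^[k] f) hTs.continuous hTc θ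
  have hval := tendsto_nhds_unique hlimA0 hlimA0c
  -- assemble
  rw [hGe, iteratedDeriv_fun_const_smul_field, hz]
  exact hval

end Split

/-! ## §2 THE JUNCTION: the all-orders rank-one jump relation with the order-0 constants -/

section Junction

variable (L : Type) [Field L] [NumberField L] (w : {w : InfinitePlace L // IsComplex w})
  {J : Matrix (Fin 2) (Fin 2) ℂ} (hJ : J = (StdForm.antidiagonal 2).over ℂ) [Fact (0 < 2 * π)]
  [MeasurableSpace ↥(unitaryGroupOfForm (starRingEnd ℂ) J)] [BorelSpace ↥(unitaryGroupOfForm (starRingEnd ℂ) J)]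
  (ν : Measure ↥(unitaryGroupOfForm (starRingEnd ℂ) J)) [ν.IsHaarMeasure] [ν.IsMulRightInvariant]
  [MeasurableSpace (↥(unitaryGroupOfForm (starRingEnd ℂ) J) ⧸ torusU (starRingEnd ℂ) J)] [BorelSpace (↥(unitaryGroupOfForm (starRingEnd ℂ) J) ⧸ torusU (starRingEnd ℂ) J)]
  (μ : Measure (↥(unitaryGroupOfForm (starRingEnd ℂ) J) ⧸ torusU (starRingEnd ℂ) J))
  [SMulInvariantMeasure ↥(unitaryGroupOfForm (starRingEnd ℂ) J) (↥(unitaryGroupOfForm (starRingEnd ℂ) J) ⧸ torusU (starRingEnd ℂ) J) μ] [IsFiniteMeasureOnCompacts μ]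

include L w hJ in
/-- **THE ALL-ORDERS RANK-ONE JUMP RELATION ON `U(1,1)` (Banach-valued test functions).**  For every two-sided Haar `ν` on `U(J)` and non-zero invariant Radon `μ` on `U(J) ⧸ T` there are
`C₁, C₂ > 0` — PINNED AT ORDER 0: (i) for `f ∈ C_c^∞`, `z ∈ S¹` the family `F_f` (bound by `hF`, ★ p850353's token shape) tends to `C₁ • cone⁺_P(f, z)` ∕ `C₁ • −cone⁻_P(f, z)` as `ψ → 0^±`;
(ii) `C₂` has the ★ (A0-c) property for every `f ∈ C_c` — such that for every `f ∈ C_c^∞(M₂(ℂ), E)`, `θ`, `F` bound by `hF` at `z = e^{iθ}`, every `G` continuous at `0` agreeing with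
`|eˣ − e⁻ˣ| • ∫_{U(J)⧸T} f(↑↑(y t_{x,θ} y⁻¹)) dμ` off `0`, and every `k`:
**EVEN** `∂^{2k}F_f → A^± ` as `ψ → 0^±` with `A⁺ − A⁻ = ((C₁∕C₂)·(−1)ᵏ) • ∂_x^{2k} G(0)` (and `A^± = ±(−1)ᵏ C₁ cone^±_P((1+Ω_J)ᵏ f)`);
**ODD** `∂^{2k+1}F_f → A` two-sidedly and `∂_x^{2k+1} G(0) = 0`.  Harish-Chandra's jump relations at all orders with ONE constant `C₁∕C₂` — Bouaziz (I₃), `d = 1`.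
[cite: Shelstad1979, Prop. 4.5 p. 26] [cite: Varadarajan1989, §6.4 Thm 24] [cite: Bouaziz1994IntegralesOrbitales, §3.2 (I₃) p. 580] [cite: Rogawski1990, Prop. 8.2.1 p. 119] -/
theorem exists_rankOne_jump_allOrders_of_eq_over (hμ : μ ≠ 0) {E : Type*} [NormedAddCommGroup E] [NormedSpace ℝ E] [CompleteSpace E]
    (ΩJ : (Matrix (Fin 2) (Fin 2) ℂ → E) → Matrix (Fin 2) (Fin 2) ℂ → E)
    (hΩJ : ∀ (g : Matrix (Fin 2) (Fin 2) ℂ → E) (Y : Matrix (Fin 2) (Fin 2) ℂ), ΩJ g Y =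
      -(fderiv ℝ (fderiv ℝ g) Y (Y * !![0, I; I, 0]) (Y * !![0, I; I, 0]) + fderiv ℝ g Y (Y * !![0, I; I, 0] * !![0, I; I, 0])) +
        (fderiv ℝ (fderiv ℝ g) Y (Y * !![1, 0; 0, -1]) (Y * !![1, 0; 0, -1]) + fderiv ℝ g Y (Y * !![1, 0; 0, -1] * !![1, 0; 0, -1])) +
        (fderiv ℝ (fderiv ℝ g) Y (Y * !![0, I; -I, 0]) (Y * !![0, I; -I, 0]) + fderiv ℝ g Y (Y * !![0, I; -I, 0] * !![0, I; -I, 0]))) :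
    ∃ C₁ C₂ : ℝ, 0 < C₁ ∧ 0 < C₂ ∧
      (∀ (z : Circle) (F : (Matrix (Fin 2) (Fin 2) ℂ → E) → ℝ → E)
        (hF : ∀ (g : Matrix (Fin 2) (Fin 2) ℂ → E) (ψ : ℝ), F g ψ = (2 * Real.sin ψ) •
          ∫ h : ↥(unitaryGroupOfForm (starRingEnd ℂ) J), g (((h * (⟨(Matrix.GeneralLinearGroup.mkOfDetNeZero !![(1 : ℂ), 1; 1, -1] det_cayleyTwo_ne_zero) * circleDiagonal 2 ![z * Circle.exp ψ, z * Circle.exp (-ψ)] * ((Matrix.GeneralLinearGroup.mkOfDetNeZero !![(1 : ℂ), 1; 1, -1] det_cayleyTwo_ne_zero))⁻¹, cayley_conj_circleDiagonal_mem_of_eq_over hJ _⟩ : ↥(unitaryGroupOfForm (starRingEnd ℂ) J)) * h⁻¹ : ↥(unitaryGroupOfForm (starRingEnd ℂ) J)) : GL (Fin 2) ℂ) : Matrix (Fin 2) (Fin 2) ℂ) ∂ν)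
        {f : Matrix (Fin 2) (Fin 2) ℂ → E}, ContDiff ℝ ∞ f → HasCompactSupport f →
          Tendsto (F f) (𝓝[>] 0) (𝓝 (C₁ • (∫ p in Ioi (0 : ℝ) ×ˢ Ioc (0 : ℝ) (2 * π),
            f ((!![(1 : ℂ), 1; 1, -1] : Matrix (Fin 2) (Fin 2) ℂ) *
              ((z : ℂ) • (1 : Matrix (Fin 2) (Fin 2) ℂ) + p.1 • Matrix.diagonal ![(z : ℂ) * I, -((z : ℂ) * I)] +
                p.1 • !![(0 : ℂ), -((z : ℂ) * I) * cexp (-((p.2 : ℂ) * I)); ((z : ℂ) * I) * cexp ((p.2 : ℂ) * I), 0]) *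
              !![(1 / 2 : ℂ), 1 / 2; 1 / 2, -(1 / 2)])))) ∧
          Tendsto (F f) (𝓝[<] 0) (𝓝 (C₁ • -(∫ p in Ioi (0 : ℝ) ×ˢ Ioc (0 : ℝ) (2 * π),
            f ((!![(1 : ℂ), 1; 1, -1] : Matrix (Fin 2) (Fin 2) ℂ) *
              ((z : ℂ) • (1 : Matrix (Fin 2) (Fin 2) ℂ) + p.1 • Matrix.diagonal ![-((z : ℂ) * I), (z : ℂ) * I] +
                p.1 • !![(0 : ℂ), ((z : ℂ) * I) * cexp (-((p.2 : ℂ) * I)); -((z : ℂ) * I) * cexp ((p.2 : ℂ) * I), 0]) *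
              !![(1 / 2 : ℂ), 1 / 2; 1 / 2, -(1 / 2)]))))) ∧
      (∀ (f : Matrix (Fin 2) (Fin 2) ℂ → E), Continuous f → HasCompactSupport f → ∀ θ : ℝ,
        Tendsto (fun x : ℝ => |Real.exp x - Real.exp (-x)| •
          ∫ y, descConj (⟨hypBlockGL x θ, hypBlockGL_mem_of_eq_over hJ x θ⟩ : ↥(unitaryGroupOfForm (starRingEnd ℂ) J)) (torusU (starRingEnd ℂ) J) (LineRing.forall_mem_torusU_comm (starRingEnd ℂ) J (hypBlockGL_mem_torusU hJ x θ)) (fun g : ↥(unitaryGroupOfForm (starRingEnd ℂ) J) => f ((g : GL (Fin 2) ℂ) : Matrix (Fin 2) (Fin 2) ℂ)) y ∂μ)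
          (𝓝[≠] 0) (𝓝 (C₂ • ((∫ p in Ioi (0 : ℝ) ×ˢ Ioc (0 : ℝ) (2 * π),
            f ((!![(1 : ℂ), 1; 1, -1] : Matrix (Fin 2) (Fin 2) ℂ) *
              (Complex.exp ((θ : ℂ) * Complex.I) • (1 : Matrix (Fin 2) (Fin 2) ℂ) +
                p.1 • Matrix.diagonal ![Complex.exp ((θ : ℂ) * Complex.I) * Complex.I, -(Complex.exp ((θ : ℂ) * Complex.I) * Complex.I)] +
                p.1 • !![(0 : ℂ), -(Complex.exp ((θ : ℂ) * Complex.I) * Complex.I) * Complex.exp (-((p.2 : ℂ) * Complex.I));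
                  (Complex.exp ((θ : ℂ) * Complex.I) * Complex.I) * Complex.exp ((p.2 : ℂ) * Complex.I), 0]) *
              !![(1 / 2 : ℂ), 1 / 2; 1 / 2, -(1 / 2)])) +
          ∫ p in Ioi (0 : ℝ) ×ˢ Ioc (0 : ℝ) (2 * π),
            f ((!![(1 : ℂ), 1; 1, -1] : Matrix (Fin 2) (Fin 2) ℂ) *
              (Complex.exp ((θ : ℂ) * Complex.I) • (1 : Matrix (Fin 2) (Fin 2) ℂ) +
                p.1 • Matrix.diagonal ![-(Complex.exp ((θ : ℂ) * Complex.I) * Complex.I), Complex.exp ((θ : ℂ) * Complex.I) * Complex.I] +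
                p.1 • !![(0 : ℂ), (Complex.exp ((θ : ℂ) * Complex.I) * Complex.I) * Complex.exp (-((p.2 : ℂ) * Complex.I));
                  -(Complex.exp ((θ : ℂ) * Complex.I) * Complex.I) * Complex.exp ((p.2 : ℂ) * Complex.I), 0]) *
              !![(1 / 2 : ℂ), 1 / 2; 1 / 2, -(1 / 2)]))))) ∧
      ∀ (f : Matrix (Fin 2) (Fin 2) ℂ → E), ContDiff ℝ ∞ f → HasCompactSupport f → ∀ (θ : ℝ) (F : (Matrix (Fin 2) (Fin 2) ℂ → E) → ℝ → E),
        (∀ (g : Matrix (Fin 2) (Fin 2) ℂ → E) (ψ : ℝ), F g ψ = (2 * Real.sin ψ) •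
          ∫ h : ↥(unitaryGroupOfForm (starRingEnd ℂ) J), g (((h * (⟨(Matrix.GeneralLinearGroup.mkOfDetNeZero !![(1 : ℂ), 1; 1, -1] det_cayleyTwo_ne_zero) * circleDiagonal 2 ![Circle.exp θ * Circle.exp ψ, Circle.exp θ * Circle.exp (-ψ)] * ((Matrix.GeneralLinearGroup.mkOfDetNeZero !![(1 : ℂ), 1; 1, -1] det_cayleyTwo_ne_zero))⁻¹,
            cayley_conj_circleDiagonal_mem_of_eq_over hJ _⟩ : ↥(unitaryGroupOfForm (starRingEnd ℂ) J)) * h⁻¹ : ↥(unitaryGroupOfForm (starRingEnd ℂ) J)) : GL (Fin 2) ℂ) : Matrix (Fin 2) (Fin 2) ℂ) ∂ν) →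
        ∀ (G : ℝ → E), ContinuousAt G 0 →
        (∀ x : ℝ, x ≠ 0 → G x = |Real.exp x - Real.exp (-x)| •
          ∫ y, descConj (⟨hypBlockGL x θ, hypBlockGL_mem_of_eq_over hJ x θ⟩ : ↥(unitaryGroupOfForm (starRingEnd ℂ) J)) (torusU (starRingEnd ℂ) J) (LineRing.forall_mem_torusU_comm (starRingEnd ℂ) J (hypBlockGL_mem_torusU hJ x θ)) (fun g : ↥(unitaryGroupOfForm (starRingEnd ℂ) J) => f ((g : GL (Fin 2) ℂ) : Matrix (Fin 2) (Fin 2) ℂ)) y ∂μ) →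
        ∀ k : ℕ,
          (∃ Ap Am : E, Tendsto (fun ψ => iteratedDeriv (2 * k) (F f) ψ) (𝓝[>] 0) (𝓝 Ap) ∧
              Tendsto (fun ψ => iteratedDeriv (2 * k) (F f) ψ) (𝓝[<] 0) (𝓝 Am) ∧
              Ap - Am = ((C₁ / C₂) * (-1 : ℝ) ^ k) • iteratedDeriv (2 * k) G 0) ∧
          (∃ A : E, Tendsto (fun ψ => iteratedDeriv (2 * k + 1) (F f) ψ) (𝓝[>] 0) (𝓝 A) ∧
              Tendsto (fun ψ => iteratedDeriv (2 * k + 1) (F f) ψ) (𝓝[<] 0) (𝓝 A) ∧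
              iteratedDeriv (2 * k + 1) G 0 = 0) := by
  obtain ⟨C₁, hC₁, hev⟩ := exists_tendsto_iteratedDeriv_even_orbitalIntegral_cayley_of_eq_over L w hJ ν ΩJ hΩJ
  obtain ⟨C, -, hodd⟩ := exists_tendsto_iteratedDeriv_odd_orbitalIntegral_cayley_of_eq_over L w hJ ν ΩJ hΩJ
  obtain ⟨C₂, hC₂, hA0c, hsplit⟩ := exists_iteratedDeriv_eq_cone_of_eqOn_abs_sub_smul_integral_descConj hJ μ hμ ΩJ hΩJ
  refine ⟨C₁, C₂, hC₁, hC₂, fun z F hF f hf hfc => ?_, hA0c, fun f hf hfc θ F hF G hG0 hG k => ⟨?_, ?_⟩⟩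
  · -- order-0 pin of `C₁`: `k = 0` of ★ FILE 4b
    have h := hev z F hF hf hfc 0
    simp only [Nat.mul_zero, iteratedDeriv_zero, pow_zero, one_smul, Function.iterate_zero, id_eq] at h
    exact h
  · -- even orders
    obtain ⟨hGT, hLT⟩ := hev (Circle.exp θ) F hF hf hfc k
    obtain ⟨hGe, -⟩ := hsplit f hf hfc θ G hG0 hG k
    refine ⟨_, _, hGT, hLT, ?_⟩
    rw [hGe, Circle.coe_exp, smul_smul (C₁ / C₂ * (-1 : ℝ) ^ k) C₂,
      show C₁ / C₂ * (-1 : ℝ) ^ k * C₂ = (-1 : ℝ) ^ k * C₁ by field_simp]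
    module
  · -- odd orders
    have h := hodd (Circle.exp θ) F hF hf hfc k
    obtain ⟨-, hGo⟩ := hsplit f hf hfc θ G hG0 hG k
    exact ⟨_, h.mono_left (nhdsGT_le_nhdsNE 0), h.mono_left (nhdsLT_le_nhdsNE 0), hGo⟩

include L w hJ in
/-- **THE ALL-ORDERS RANK-ONE JUMP RELATION, `E = ℂ`, IN THE TREE'S ONE-SIDED-JUMP CURRENCY** (★ `HasOneSidedJump`, the shape of ★ `ArchHcJump`'s clause (I₃) with Cayley scalar `iⁿ`):
with the order-0 constants `C₁, C₂ > 0` of `exists_rankOne_jump_allOrders_of_eq_over` (same pins), for every `f ∈ C_c^∞(M₂(ℂ), ℂ)`, `θ`, `F` bound by `hF` at `z = e^{iθ}`, `G` continuous at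
`0` agreeing with the normalised split orbital integral off `0`, and EVERY `n`:
  **`HasOneSidedJump (ψ ↦ ∂_ψⁿ F_f ψ) ((C₁∕C₂ : ℂ) · iⁿ · ∂_xⁿ G(0))`.**
[cite: Shelstad1979, Prop. 4.5 p. 26] [cite: Bouaziz1994IntegralesOrbitales, §3.2 (I₃) p. 580] [cite: Varadarajan1989, §6.4 Thm 24] [cite: Rogawski1990, Prop. 8.2.1 p. 119] -/
theorem exists_hasOneSidedJump_iteratedDeriv_allOrders_of_eq_over (hμ : μ ≠ 0) (ΩJ : (Matrix (Fin 2) (Fin 2) ℂ → ℂ) → Matrix (Fin 2) (Fin 2) ℂ → ℂ)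
    (hΩJ : ∀ (g : Matrix (Fin 2) (Fin 2) ℂ → ℂ) (Y : Matrix (Fin 2) (Fin 2) ℂ), ΩJ g Y =
      -(fderiv ℝ (fderiv ℝ g) Y (Y * !![0, I; I, 0]) (Y * !![0, I; I, 0]) + fderiv ℝ g Y (Y * !![0, I; I, 0] * !![0, I; I, 0])) +
        (fderiv ℝ (fderiv ℝ g) Y (Y * !![1, 0; 0, -1]) (Y * !![1, 0; 0, -1]) + fderiv ℝ g Y (Y * !![1, 0; 0, -1] * !![1, 0; 0, -1])) +
        (fderiv ℝ (fderiv ℝ g) Y (Y * !![0, I; -I, 0]) (Y * !![0, I; -I, 0]) + fderiv ℝ g Y (Y * !![0, I; -I, 0] * !![0, I; -I, 0]))) :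
    ∃ C₁ C₂ : ℝ, 0 < C₁ ∧ 0 < C₂ ∧
      (∀ (z : Circle) (F : (Matrix (Fin 2) (Fin 2) ℂ → ℂ) → ℝ → ℂ)
        (hF : ∀ (g : Matrix (Fin 2) (Fin 2) ℂ → ℂ) (ψ : ℝ), F g ψ = (2 * Real.sin ψ) •
          ∫ h : ↥(unitaryGroupOfForm (starRingEnd ℂ) J), g (((h * (⟨(Matrix.GeneralLinearGroup.mkOfDetNeZero !![(1 : ℂ), 1; 1, -1] det_cayleyTwo_ne_zero) * circleDiagonal 2 ![z * Circle.exp ψ, z * Circle.exp (-ψ)] * ((Matrix.GeneralLinearGroup.mkOfDetNeZero !![(1 : ℂ), 1; 1, -1] det_cayleyTwo_ne_zero))⁻¹, cayley_conj_circleDiagonal_mem_of_eq_over hJ _⟩ : ↥(unitaryGroupOfForm (starRingEnd ℂ) J)) * h⁻¹ : ↥(unitaryGroupOfForm (starRingEnd ℂ) J)) : GL (Fin 2) ℂ) : Matrix (Fin 2) (Fin 2) ℂ) ∂ν)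
        {f : Matrix (Fin 2) (Fin 2) ℂ → ℂ}, ContDiff ℝ ∞ f → HasCompactSupport f →
          Tendsto (F f) (𝓝[>] 0) (𝓝 (C₁ • (∫ p in Ioi (0 : ℝ) ×ˢ Ioc (0 : ℝ) (2 * π),
            f ((!![(1 : ℂ), 1; 1, -1] : Matrix (Fin 2) (Fin 2) ℂ) *
              ((z : ℂ) • (1 : Matrix (Fin 2) (Fin 2) ℂ) + p.1 • Matrix.diagonal ![(z : ℂ) * I, -((z : ℂ) * I)] +
                p.1 • !![(0 : ℂ), -((z : ℂ) * I) * cexp (-((p.2 : ℂ) * I)); ((z : ℂ) * I) * cexp ((p.2 : ℂ) * I), 0]) *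
              !![(1 / 2 : ℂ), 1 / 2; 1 / 2, -(1 / 2)])))) ∧
          Tendsto (F f) (𝓝[<] 0) (𝓝 (C₁ • -(∫ p in Ioi (0 : ℝ) ×ˢ Ioc (0 : ℝ) (2 * π),
            f ((!![(1 : ℂ), 1; 1, -1] : Matrix (Fin 2) (Fin 2) ℂ) *
              ((z : ℂ) • (1 : Matrix (Fin 2) (Fin 2) ℂ) + p.1 • Matrix.diagonal ![-((z : ℂ) * I), (z : ℂ) * I] +
                p.1 • !![(0 : ℂ), ((z : ℂ) * I) * cexp (-((p.2 : ℂ) * I)); -((z : ℂ) * I) * cexp ((p.2 : ℂ) * I), 0]) *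
              !![(1 / 2 : ℂ), 1 / 2; 1 / 2, -(1 / 2)]))))) ∧
      (∀ (f : Matrix (Fin 2) (Fin 2) ℂ → ℂ), Continuous f → HasCompactSupport f → ∀ θ : ℝ,
        Tendsto (fun x : ℝ => |Real.exp x - Real.exp (-x)| •
          ∫ y, descConj (⟨hypBlockGL x θ, hypBlockGL_mem_of_eq_over hJ x θ⟩ : ↥(unitaryGroupOfForm (starRingEnd ℂ) J)) (torusU (starRingEnd ℂ) J) (LineRing.forall_mem_torusU_comm (starRingEnd ℂ) J (hypBlockGL_mem_torusU hJ x θ)) (fun g : ↥(unitaryGroupOfForm (starRingEnd ℂ) J) => f ((g : GL (Fin 2) ℂ) : Matrix (Fin 2) (Fin 2) ℂ)) y ∂μ)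
          (𝓝[≠] 0) (𝓝 (C₂ • ((∫ p in Ioi (0 : ℝ) ×ˢ Ioc (0 : ℝ) (2 * π),
            f ((!![(1 : ℂ), 1; 1, -1] : Matrix (Fin 2) (Fin 2) ℂ) *
              (Complex.exp ((θ : ℂ) * Complex.I) • (1 : Matrix (Fin 2) (Fin 2) ℂ) +
                p.1 • Matrix.diagonal ![Complex.exp ((θ : ℂ) * Complex.I) * Complex.I, -(Complex.exp ((θ : ℂ) * Complex.I) * Complex.I)] +
                p.1 • !![(0 : ℂ), -(Complex.exp ((θ : ℂ) * Complex.I) * Complex.I) * Complex.exp (-((p.2 : ℂ) * Complex.I));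
                  (Complex.exp ((θ : ℂ) * Complex.I) * Complex.I) * Complex.exp ((p.2 : ℂ) * Complex.I), 0]) *
              !![(1 / 2 : ℂ), 1 / 2; 1 / 2, -(1 / 2)])) +
          ∫ p in Ioi (0 : ℝ) ×ˢ Ioc (0 : ℝ) (2 * π),
            f ((!![(1 : ℂ), 1; 1, -1] : Matrix (Fin 2) (Fin 2) ℂ) *
              (Complex.exp ((θ : ℂ) * Complex.I) • (1 : Matrix (Fin 2) (Fin 2) ℂ) +
                p.1 • Matrix.diagonal ![-(Complex.exp ((θ : ℂ) * Complex.I) * Complex.I), Complex.exp ((θ : ℂ) * Complex.I) * Complex.I] +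
                p.1 • !![(0 : ℂ), (Complex.exp ((θ : ℂ) * Complex.I) * Complex.I) * Complex.exp (-((p.2 : ℂ) * Complex.I));
                  -(Complex.exp ((θ : ℂ) * Complex.I) * Complex.I) * Complex.exp ((p.2 : ℂ) * Complex.I), 0]) *
              !![(1 / 2 : ℂ), 1 / 2; 1 / 2, -(1 / 2)]))))) ∧
      ∀ (f : Matrix (Fin 2) (Fin 2) ℂ → ℂ), ContDiff ℝ ∞ f → HasCompactSupport f → ∀ (θ : ℝ) (F : (Matrix (Fin 2) (Fin 2) ℂ → ℂ) → ℝ → ℂ),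
        (∀ (g : Matrix (Fin 2) (Fin 2) ℂ → ℂ) (ψ : ℝ), F g ψ = (2 * Real.sin ψ) •
          ∫ h : ↥(unitaryGroupOfForm (starRingEnd ℂ) J), g (((h * (⟨(Matrix.GeneralLinearGroup.mkOfDetNeZero !![(1 : ℂ), 1; 1, -1] det_cayleyTwo_ne_zero) * circleDiagonal 2 ![Circle.exp θ * Circle.exp ψ, Circle.exp θ * Circle.exp (-ψ)] * ((Matrix.GeneralLinearGroup.mkOfDetNeZero !![(1 : ℂ), 1; 1, -1] det_cayleyTwo_ne_zero))⁻¹,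
            cayley_conj_circleDiagonal_mem_of_eq_over hJ _⟩ : ↥(unitaryGroupOfForm (starRingEnd ℂ) J)) * h⁻¹ : ↥(unitaryGroupOfForm (starRingEnd ℂ) J)) : GL (Fin 2) ℂ) : Matrix (Fin 2) (Fin 2) ℂ) ∂ν) →
        ∀ (G : ℝ → ℂ), ContinuousAt G 0 →
        (∀ x : ℝ, x ≠ 0 → G x = |Real.exp x - Real.exp (-x)| •
          ∫ y, descConj (⟨hypBlockGL x θ, hypBlockGL_mem_of_eq_over hJ x θ⟩ : ↥(unitaryGroupOfForm (starRingEnd ℂ) J)) (torusU (starRingEnd ℂ) J) (LineRing.forall_mem_torusU_comm (starRingEnd ℂ) J (hypBlockGL_mem_torusU hJ x θ)) (fun g : ↥(unitaryGroupOfForm (starRingEnd ℂ) J) => f ((g : GL (Fin 2) ℂ) : Matrix (Fin 2) (Fin 2) ℂ)) y ∂μ) →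
        ∀ n : ℕ, HasOneSidedJump (fun ψ : ℝ => iteratedDeriv n (F f) ψ) (((C₁ / C₂ : ℝ) : ℂ) * Complex.I ^ n * iteratedDeriv n G 0) := by
  obtain ⟨C₁, C₂, hC₁, hC₂, hpin₁, hpin₂, hall⟩ := exists_rankOne_jump_allOrders_of_eq_over L w hJ ν μ hμ (E := ℂ) ΩJ hΩJ
  refine ⟨C₁, C₂, hC₁, hC₂, hpin₁, hpin₂, fun f hf hfc θ F hF G hG0 hG n => ?_⟩
  obtain ⟨k, rfl | rfl⟩ := Nat.even_or_odd' n
  · obtain ⟨⟨Ap, Am, hp, hm, hdiff⟩, -⟩ := hall f hf hfc θ F hF G hG0 hG k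
    refine ⟨Ap, Am, hp, hm, ?_⟩
    rw [hdiff, pow_mul, Complex.I_sq, Complex.real_smul]
    push_cast
    ring
  · obtain ⟨-, ⟨A, hp, hm, hG0'⟩⟩ := hall f hf hfc θ F hF G hG0 hG k
    refine ⟨A, A, hp, hm, ?_⟩
    rw [hG0', sub_self, mul_zero]

end Junction

end UnitaryGroup

end Literature.NumberTheory.Automorphic

end
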